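import Mathlib.Tactic

/-!
# PercRepro — Kronecker polynomial identity testing, I: the data and the evaluators (p4, gen 27)

Polynomials in two variables `a, b` with integer coefficients as flat data (`Poly`, decoded from `List Nat`),
polynomial expressions over them (`PExpr`: leaves, variables, constants, `+`, `·`, `−`, and the composition of a
leaf with two expressions), their evaluation in any commutative ring (`evalP`, `evalE`), the kernel-side evaluation at
the Kronecker point `a = 2^(K·M)`, `b = 2^K` (`kronE`, big integers through `Nat.pow` and power tables), the structural
bounds (`l1E`: ℓ¹-norm, `degAE`, `degBE`: degrees — never expanding a product), and the formal expansion `toPoly`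
(proof side only).  The theorem `pitE` is in KroneckerPIT; the lemmas about the expansion in KroneckerPITLemmas.
-/

namespace PercRepro.PIT

/-- A term `c · a^ea · b^eb` is the triple `(ea, eb, c)`. -/
abbrev Term := Nat × Nat × Int

/-- A polynomial as a list of terms (repetitions allowed). -/
abbrev Poly := List Term

/-- Polynomial expressions over data polynomials. -/
inductive PExpr where
  | leaf (p : Poly)
  | va
  | vb
  | const (c : Int)
  | add (e₁ e₂ : PExpr)
  | mul (e₁ e₂ : PExpr)
  | neg (e : PExpr)
  | comp (p : Poly) (ea eb : PExpr)

section eval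

variable {R : Type*} [CommRing R]

/-- Evaluation of a data polynomial. -/
def evalP (x y : R) : Poly → R
  | [] => 0
  | (ea, eb, c) :: p => (c : R) * x ^ ea * y ^ eb + evalP x y p

/-- Evaluation of an expression. -/
def evalE (x y : R) : PExpr → R
  | .leaf p => evalP x y p
  | .va => x
  | .vb => y
  | .const c => (c : R)
  | .add e₁ e₂ => evalE x y e₁ + evalE x y e₂
  | .mul e₁ e₂ => evalE x y e₁ * evalE x y e₂
  | .neg e => - evalE x y e
  | .comp p ea eb => evalP (evalE x y ea) (evalE x y eb) p

end eval

/-! ## The structural bounds -/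

/-- ℓ¹-norm of a data polynomial. -/
def l1P : Poly → Nat
  | [] => 0
  | (_, _, c) :: p => c.natAbs + l1P p

/-- `a`-degree bound. -/
def degAP : Poly → Nat
  | [] => 0
  | (ea, _, _) :: p => max ea (degAP p)

/-- `b`-degree bound. -/
def degBP : Poly → Nat
  | [] => 0
  | (_, eb, _) :: p => max eb (degBP p)

/-- `Σ |c| · la^ea · lb^eb`: the ℓ¹-norm bound of a composed leaf. -/
def l1Comp (la lb : Nat) : Poly → Nat
  | [] => 0
  | (ea, eb, c) :: p => c.natAbs * la ^ ea * lb ^ eb + l1Comp la lb p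

/-- ℓ¹-norm bound of an expression (sub-multiplicative). -/
def l1E : PExpr → Nat
  | .leaf p => l1P p
  | .va => 1
  | .vb => 1
  | .const c => c.natAbs
  | .add e₁ e₂ => l1E e₁ + l1E e₂
  | .mul e₁ e₂ => l1E e₁ * l1E e₂
  | .neg e => l1E e
  | .comp p ea eb => l1Comp (l1E ea) (l1E eb) p

/-- `a`-degree bound of an expression. -/
def degAE : PExpr → Nat
  | .leaf p => degAP p
  | .va => 1
  | .vb => 0
  | .const _ => 0
  | .add e₁ e₂ => max (degAE e₁) (degAE e₂)
  | .mul e₁ e₂ => degAE e₁ + degAE e₂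
  | .neg e => degAE e
  | .comp p ea eb => degAP p * degAE ea + degBP p * degAE eb

/-- `b`-degree bound of an expression. -/
def degBE : PExpr → Nat
  | .leaf p => degBP p
  | .va => 0
  | .vb => 1
  | .const _ => 0
  | .add e₁ e₂ => max (degBE e₁) (degBE e₂)
  | .mul e₁ e₂ => degBE e₁ + degBE e₂
  | .neg e => degBE e
  | .comp p ea eb => degAP p * degBE ea + degBP p * degBE eb

/-! ## Flat data: `ea, eb, sign, |c|` per term (cheap to elaborate) -/

/-- Decode a flat list of naturals (four per term: `ea`, `eb`, sign `0/1`, magnitude). -/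
def decodeF : Nat → List Nat → Poly
  | 0, _ => []
  | fuel + 1, ea :: eb :: s :: c :: rest => (ea, eb, if s == 0 then (c : Int) else -(c : Int)) :: decodeF fuel rest
  | _ + 1, _ => []

/-- Decode a flat list of naturals. -/
def decode (l : List Nat) : Poly := decodeF l.length l

/-! ## The kernel-side evaluation at the Kronecker point -/

/-- `Σ c · 2^(K·(M·ea + eb))`, computed with `Nat.pow` (kernel-accelerated). -/
def kronP (K M : Nat) : Poly → Int
  | [] => 0
  | (ea, eb, c) :: p => c * ((2 ^ (K * (M * ea + eb)) : Nat) : Int) + kronP K M p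

/-- `[acc, acc·x, …, acc·x^n]`. -/
def powTabAux (x : Int) (acc : Int) : Nat → List Int
  | 0 => [acc]
  | n + 1 => acc :: powTabAux x (acc * x) n

/-- `[x^0, x^1, …, x^n]`. -/
def powTab (x : Int) (n : Nat) : List Int := powTabAux x 1 n

/-- Evaluation of a data polynomial at an integer point through two power tables (no repeated powers). -/
def evalPT (tx ty : List Int) : Poly → Int
  | [] => 0
  | (ea, eb, c) :: p => c * tx.getD ea 0 * ty.getD eb 0 + evalPT tx ty p

/-- The expression evaluated at the Kronecker point. -/
def kronE (K M : Nat) : PExpr → Int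
  | .leaf p => kronP K M p
  | .va => ((2 ^ (K * M) : Nat) : Int)
  | .vb => ((2 ^ K : Nat) : Int)
  | .const c => c
  | .add e₁ e₂ => kronE K M e₁ + kronE K M e₂
  | .mul e₁ e₂ => kronE K M e₁ * kronE K M e₂
  | .neg e => - kronE K M e
  | .comp p ea eb =>
    evalPT (powTab (kronE K M ea) (degAP p)) (powTab (kronE K M eb) (degBP p)) p

/-! ## The symbolic expansion (proof side only) -/

/-- `t · q` termwise. -/
def scaleP (t : Term) : Poly → Poly
  | [] => []
  | (ea, eb, c) :: p => (t.1 + ea, t.2.1 + eb, t.2.2 * c) :: scaleP t p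

/-- Product of data polynomials. -/
def mulP : Poly → Poly → Poly
  | [], _ => []
  | t :: p, q => scaleP t q ++ mulP p q

/-- Negation. -/
def negP : Poly → Poly
  | [] => []
  | (ea, eb, c) :: p => (ea, eb, -c) :: negP p

/-- Power. -/
def powP (p : Poly) : Nat → Poly
  | 0 => [(0, 0, 1)]
  | n + 1 => mulP (powP p n) p

/-- Substitution `p(pa, pb)`. -/
def substP (pa pb : Poly) : Poly → Poly
  | [] => []
  | (ea, eb, c) :: p => scaleP (0, 0, c) (mulP (powP pa ea) (powP pb eb)) ++ substP pa pb p

/-- The expansion of an expression. -/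
def toPoly : PExpr → Poly
  | .leaf p => p
  | .va => [(1, 0, 1)]
  | .vb => [(0, 1, 1)]
  | .const c => [(0, 0, c)]
  | .add e₁ e₂ => toPoly e₁ ++ toPoly e₂
  | .mul e₁ e₂ => mulP (toPoly e₁) (toPoly e₂)
  | .neg e => negP (toPoly e)
  | .comp p ea eb => substP (toPoly ea) (toPoly eb) p

end PercRepro.PIT
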